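import Literature.NumberTheory.Rogawski1990.AdelicStableConjugacyG2
import Literature.NumberTheory.Rogawski1990.PreStabilisationCount
import HarnessLib

/-!
# The pre-stabilisation count ON THE SELF CARRIER: `Σ_{[γ] ⊂ 𝒪_st(γ₀)} Φ([toAdelic γ], f) = |𝓡|⁻¹ Σ_{κ ∈ 𝓡} Φ^κ_{𝐀}(γ₀, f)` over `𝒞′_𝐀(γ₀) =
# MatchingAdeleG₂.classes L H H γ₀`, from Prop. 3.3.1 in ★ T1b-9's ELEMENT form and `k(γ₀) = 1` (Rogawski 1990, §5.4 pp. 72–74, §3.3 p. 22, §14.5 p. 238)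

Topic `NumberTheory/Rogawski1990`; namespace `Literature.NumberTheory.Rogawski1990`; **THEOREMS ONLY** (no definition, no named fact, no instance, no notation,
no `sorry`).  Cell `pub/hodgecm-mathlib`, ENGINE T1 (crux H413 = `stmt-HodgeConjecture-24833`), row O11 steps S4 + S5: the CM dress of ★ `PreStabilisationCount`
(carrier-generic count) on ★ `AdelicStableConjugacyG2` (the γ₀-indexed self carrier), in the shape of the per-γ₀ «stabilisation package» of `PLAN-T1 v2` §2 (a)
(RULING #91 LEAD DECISION #2): data `(A, obs : MatchingAdeleG₂ L H H γ₀ → A, 𝓡 ≤ Â finite, e : I ↪ 𝓡 ∖ {1})`, clauses = HYPOTHESES here (Prop. 3.3.1 in ★ T1b-9's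
element form `hHasse`, `k(γ₀) = 1` as `hinj`, the (5.4.5) bijection as `he1 ∕ heinj ∕ hsurj`).  HC_CM is proved only modulo the printed citations until rung 0 closes.

* `MatchingAdeleG₂.forall_addChar_obs_eq_one_iff_mem_image` — the element-form Hasse clause gives the class-form one (★ `exists_isRationalOver_iff_mk_mem_image`);
* **`MatchingAdeleG₂.stableOrbitalSum_map_toAdelic_eq_inv_card_mul_sum`** — for class weights `w κ` READING `κ ∘ obs` (`w κ [p] = κ(obs p)`; e.g. the E-κ weights
  `w_Δ(𝒪H)` under ★ `GlobalKappaFormula`): `Σᶠ_{c ∈ 𝒞′} Φ_m(map toAdelic c, f) = |𝓡|⁻¹ Σ_{κ ∈ 𝓡} adelicKappaOrbitalSum 𝒞′_𝐀(γ₀) (w κ) m f`;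
* **`…_eq_inv_card_mul_stable_add_sum`** — print's final shape `|𝓡|⁻¹ · (Φ^{st,𝐀}(γ₀, f) + Σ_{i ∈ I} Φ^{w(e i),𝐀}(γ₀, f))`, `|𝓡| = |I| + 1`;
* **`…_eq_of_equiv`** — THE PACKAGE READING: `κ : I ≃ {χ ∈ 𝓡 ∣ χ ≠ 1}` (PLAN v2 §2 (a)) and one weight `W i` per endoscopic class, plus `|𝓡| = |I| + 1`;
* `…_eq_adelicStableOrbitalSum_of_forall_isRationalOver` — type (3) (`𝓡 = 1`: every matching adèle rational).

## References
* [Rogawski1990] J. D. Rogawski, *Automorphic Representations of Unitary Groups in Three Variables*, Ann. of Math. Stud. 123 (1990), §3.3 Prop. 3.3.1 ∕ Cor. 3.3.2 p. 22,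
  §5.4 (5.4.1)–(5.4.5) pp. 72–74, §14.5 p. 238.
* [Kottwitz1986] R. E. Kottwitz, *Stable trace formula: elliptic singular terms*, Math. Ann. 275 (1986), §9.
-/

set_option autoImplicit false

noncomputable section

open NumberField IsDedekindDomain
open scoped BigOperators MatrixGroups

namespace Literature.NumberTheory.Rogawski1990

open Literature.NumberTheory.Automorphic
open Literature.AlgebraicGeometry.ShimuraVarieties (unitaryGroup)

section Self

variable {L : Type} [Field L] [NumberField L] [IsCMField L] {H : Matrix (Fin 3) (Fin 3) L} {γ₀ : (UnitaryGroup.cmDatum L 3 H).Rational}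
variable {A : Type*} [AddCommGroup A] (𝓡 : Subgroup (AddChar A ℂ)) [Fintype 𝓡] (obs : MatchingAdeleG₂ L H H γ₀ → A)
variable [∀ g : (UnitaryGroup.cmDatum L 3 H).Adelic,
  MeasurableSpace ((UnitaryGroup.cmDatum L 3 H).Adelic ⧸ Subgroup.centralizer ({g} : Set (UnitaryGroup.cmDatum L 3 H).Adelic))]

omit [Fintype 𝓡] [∀ g : (UnitaryGroup.cmDatum L 3 H).Adelic,
  MeasurableSpace ((UnitaryGroup.cmDatum L 3 H).Adelic ⧸ Subgroup.centralizer ({g} : Set (UnitaryGroup.cmDatum L 3 H).Adelic))] in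
/-- **Prop. 3.3.1, element form ⇒ class form**: if `(∀ κ ∈ 𝓡, κ(obs p) = 1) ↔ ∃ γ, p.IsRationalOver γ` for every matching adèle `p` over `γ₀`, and class weights
`w κ` read `κ ∘ obs` (`w κ [p] = κ(obs p)`), then for every class `δ ∈ 𝒞′_𝐀(γ₀)`: `(∀ κ ∈ 𝓡, w κ δ = 1) ↔ δ ∈ map toAdelic '' conjClassesIn γ₀`
(★ `exists_isRationalOver_iff_mk_mem_image`: rational over SOME `γ` forces `γ ∼_st γ₀`). [cite: Rogawski1990, §3.3 Prop. 3.3.1 p. 22; §5.4 p. 72] -/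
theorem MatchingAdeleG₂.forall_eq_one_iff_mem_image (hHasse : ∀ p : MatchingAdeleG₂ L H H γ₀, (∀ κ ∈ 𝓡, κ (obs p) = 1) ↔ ∃ γ, p.IsRationalOver γ)
    (w : 𝓡 → ConjClasses (UnitaryGroup.cmDatum L 3 H).Adelic → ℂ)
    (hw : ∀ (κ : 𝓡) (p : MatchingAdeleG₂ L H H γ₀), w κ (ConjClasses.mk p.adele) = (κ : AddChar A ℂ) (obs p))
    {δ : ConjClasses (UnitaryGroup.cmDatum L 3 H).Adelic} (hδ : δ ∈ MatchingAdeleG₂.classes L H H γ₀) :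
    (∀ κ : 𝓡, w κ δ = 1) ↔ δ ∈ ConjClasses.map (UnitaryGroup.cmDatum L 3 H).toAdelic '' conjClassesIn (cmConjRingHom L) H γ₀ := by
  obtain ⟨p, rfl⟩ := hδ
  rw [← p.exists_isRationalOver_iff_mk_mem_image, ← hHasse p]
  constructor
  · intro h κ hκ
    have := h ⟨κ, hκ⟩
    rwa [hw] at this
  · intro h κ
    rw [hw]
    exact h κ κ.2

/-- **THE COUNT ON THE SELF CARRIER, (5.4.1) ⇒ (5.4.2)**: under Prop. 3.3.1 (element form, `hHasse`), `k(γ₀) = 1` (`hinj`), and class weights `w κ` reading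
`κ ∘ obs` (`hw`), for every class-indexed orbital family `m` on `U(H)(𝐀)` and `f` with `Φ_m(·, f)` finitely supported on `𝒞′_𝐀(γ₀)`:
`Σ_{[γ] ⊂ 𝒪_st(γ₀)} Φ_m([toAdelic γ], f) = |𝓡|⁻¹ Σ_{κ ∈ 𝓡} adelicKappaOrbitalSum 𝒞′_𝐀(γ₀) (w κ) m f`. [cite: Rogawski1990, §5.4 (5.4.1)–(5.4.3) pp. 72–73; §14.5 p. 238]
[cite: Kottwitz1986, §9] -/
theorem MatchingAdeleG₂.stableOrbitalSum_map_toAdelic_eq_inv_card_mul_sum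
    (hHasse : ∀ p : MatchingAdeleG₂ L H H γ₀, (∀ κ ∈ 𝓡, κ (obs p) = 1) ↔ ∃ γ, p.IsRationalOver γ)
    (hinj : Set.InjOn (ConjClasses.map (UnitaryGroup.cmDatum L 3 H).toAdelic) (conjClassesIn (cmConjRingHom L) H γ₀))
    (w : 𝓡 → ConjClasses (UnitaryGroup.cmDatum L 3 H).Adelic → ℂ)
    (hw : ∀ (κ : 𝓡) (p : MatchingAdeleG₂ L H H γ₀), w κ (ConjClasses.mk p.adele) = (κ : AddChar A ℂ) (obs p))
    (m : OrbitalMeasureFamily (UnitaryGroup.cmDatum L 3 H).Adelic) (f : (UnitaryGroup.cmDatum L 3 H).Adelic → ℂ)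
    (hfin : (MatchingAdeleG₂.classes L H H γ₀ ∩ Function.support fun δ => classOrbitalIntegral m f δ).Finite) :
    stableOrbitalSum (cmConjRingHom L) H (fun c => classOrbitalIntegral m f (ConjClasses.map (UnitaryGroup.cmDatum L 3 H).toAdelic c)) γ₀ =
      (Fintype.card 𝓡 : ℂ)⁻¹ * ∑ κ : 𝓡, adelicKappaOrbitalSum (MatchingAdeleG₂.classes L H H γ₀) (w κ) m f := by
  classical
  -- class-level obstruction: the obstruction of SOME matching adèle in the class (junk `0` off `𝒞′_𝐀(γ₀)`)
  let obsC : ConjClasses (UnitaryGroup.cmDatum L 3 H).Adelic → A := fun δ =>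
    if h : δ ∈ MatchingAdeleG₂.classes L H H γ₀ then obs h.choose else 0
  have hobsC : ∀ (κ : 𝓡) {δ}, δ ∈ MatchingAdeleG₂.classes L H H γ₀ → (κ : AddChar A ℂ) (obsC δ) = w κ δ := by
    intro κ δ hδ
    have hc : ConjClasses.mk (hδ.choose).adele = δ := hδ.choose_spec
    simp only [obsC, dif_pos hδ]
    rw [← hw κ hδ.choose, hc]
  have hHasseC : ∀ δ ∈ MatchingAdeleG₂.classes L H H γ₀, (∀ κ ∈ 𝓡, κ (obsC δ) = 1) ↔
      δ ∈ ConjClasses.map (UnitaryGroup.cmDatum L 3 H).toAdelic '' conjClassesIn (cmConjRingHom L) H γ₀ := by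
    intro δ hδ
    rw [← MatchingAdeleG₂.forall_eq_one_iff_mem_image 𝓡 obs hHasse w hw hδ]
    exact ⟨fun h κ => by rw [← hobsC κ hδ]; exact h κ κ.2, fun h κ hκ => by rw [hobsC ⟨κ, hκ⟩ hδ]; exact h ⟨κ, hκ⟩⟩
  have key := stableOrbitalSum_comp_eq_inv_card_mul_sum_adelicKappaOrbitalSum (cmConjRingHom L) H γ₀ 𝓡 obsC (MatchingAdeleG₂.classes L H H γ₀)
    (ConjClasses.map (UnitaryGroup.cmDatum L 3 H).toAdelic) m f hinj (fun c hc => MatchingAdeleG₂.map_toAdelic_mem_classes γ₀ hc) hHasseC hfin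
  refine key.trans ?_
  congr 1
  refine Finset.sum_congr rfl fun κ _ => ?_
  simp only [adelicKappaOrbitalSum]
  exact finsum_mem_congr rfl fun δ hδ => by rw [hobsC κ hδ]

/-- **… IN PRINT'S FINAL SHAPE** with the non-trivial characters parametrised by a finite type `I` (`{𝒪H ↦ 𝒪_st(γ₀)}`, (5.4.5)) through `e : I → 𝓡`:
`Σ_{[γ] ⊂ 𝒪_st(γ₀)} Φ_m([toAdelic γ], f) = |𝓡|⁻¹ · (Φ^{st,𝐀}(γ₀, f) + Σ_{i ∈ I} Φ^{w(e i),𝐀}(γ₀, f))`, `Φ^{st,𝐀} = adelicStableOrbitalSum 𝒞′_𝐀(γ₀) m f`.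
[cite: Rogawski1990, §5.4 (5.4.3)–(5.4.5) pp. 73–74; §14.5 Thm. 14.5.1 (a) p. 238] [cite: Kottwitz1986, §9] -/
theorem MatchingAdeleG₂.stableOrbitalSum_map_toAdelic_eq_inv_card_mul_stable_add_sum {I : Type*} [Fintype I] (e : I → 𝓡) (he1 : ∀ i, e i ≠ 1)
    (heinj : Function.Injective e) (hsurj : ∀ κ : 𝓡, κ ≠ 1 → ∃ i, e i = κ)
    (hHasse : ∀ p : MatchingAdeleG₂ L H H γ₀, (∀ κ ∈ 𝓡, κ (obs p) = 1) ↔ ∃ γ, p.IsRationalOver γ)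
    (hinj : Set.InjOn (ConjClasses.map (UnitaryGroup.cmDatum L 3 H).toAdelic) (conjClassesIn (cmConjRingHom L) H γ₀))
    (w : 𝓡 → ConjClasses (UnitaryGroup.cmDatum L 3 H).Adelic → ℂ)
    (hw : ∀ (κ : 𝓡) (p : MatchingAdeleG₂ L H H γ₀), w κ (ConjClasses.mk p.adele) = (κ : AddChar A ℂ) (obs p))
    (m : OrbitalMeasureFamily (UnitaryGroup.cmDatum L 3 H).Adelic) (f : (UnitaryGroup.cmDatum L 3 H).Adelic → ℂ)
    (hfin : (MatchingAdeleG₂.classes L H H γ₀ ∩ Function.support fun δ => classOrbitalIntegral m f δ).Finite) :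
    stableOrbitalSum (cmConjRingHom L) H (fun c => classOrbitalIntegral m f (ConjClasses.map (UnitaryGroup.cmDatum L 3 H).toAdelic c)) γ₀ =
      (Fintype.card 𝓡 : ℂ)⁻¹ * (adelicStableOrbitalSum (MatchingAdeleG₂.classes L H H γ₀) m f +
        ∑ i, adelicKappaOrbitalSum (MatchingAdeleG₂.classes L H H γ₀) (w (e i)) m f) := by
  refine (MatchingAdeleG₂.stableOrbitalSum_map_toAdelic_eq_inv_card_mul_sum 𝓡 obs hHasse hinj w hw m f hfin).trans ?_
  rw [sum_subgroup_eq_apply_one_add_sum 𝓡 e he1 heinj hsurj]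
  congr 2
  -- the `κ = 1` term is the stable sum: `w 1 ≡ 1` on `𝒞′_𝐀(γ₀)`
  simp only [adelicKappaOrbitalSum, adelicStableOrbitalSum]
  refine finsum_mem_congr rfl fun δ hδ => ?_
  obtain ⟨p, rfl⟩ := hδ
  rw [hw, Subgroup.coe_one, AddChar.one_apply, one_mul]

/-- **THE PACKAGE READING** (the exact shape of `PLAN-T1 v2` §2 (a): `κ : I ≃ {χ ∈ 𝓡 ∣ χ ≠ 1}`, `I = {𝒪H ↦ 𝒪_st(γ₀)}`), with ONE weight function per endoscopic class
`W i` reading `κ(i) ∘ obs` on the matching adèles (`hW : W i [q] = κ(i)(obs q)` — the E-κ weights of (4.3.3) under ★ `GlobalKappaFormula`), no weight needed at `κ = 1`: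
`Σ_{[γ] ⊂ 𝒪_st(γ₀)} Φ_m([toAdelic γ], f) = |𝓡|⁻¹ · (Φ^{st,𝐀}(γ₀, f) + Σ_{i ∈ I} adelicKappaOrbitalSum 𝒞′_𝐀(γ₀) (W i) m f)` and `|𝓡| = |I| + 1`.
[cite: Rogawski1990, §5.4 (5.4.2)–(5.4.5) pp. 72–74; §14.5 Thm. 14.5.1 (a) p. 238] [cite: Kottwitz1986, §9] -/
theorem MatchingAdeleG₂.stableOrbitalSum_map_toAdelic_eq_of_equiv {I : Type*} [Fintype I] (e : I ≃ {χ : 𝓡 // χ ≠ 1})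
    (hHasse : ∀ p : MatchingAdeleG₂ L H H γ₀, (∀ κ ∈ 𝓡, κ (obs p) = 1) ↔ ∃ γ, p.IsRationalOver γ)
    (hinj : Set.InjOn (ConjClasses.map (UnitaryGroup.cmDatum L 3 H).toAdelic) (conjClassesIn (cmConjRingHom L) H γ₀))
    (W : I → ConjClasses (UnitaryGroup.cmDatum L 3 H).Adelic → ℂ)
    (hW : ∀ (i : I) (q : MatchingAdeleG₂ L H H γ₀), W i (ConjClasses.mk q.adele) = (((e i : 𝓡) : 𝓡) : AddChar A ℂ) (obs q))
    (m : OrbitalMeasureFamily (UnitaryGroup.cmDatum L 3 H).Adelic) (f : (UnitaryGroup.cmDatum L 3 H).Adelic → ℂ)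
    (hfin : (MatchingAdeleG₂.classes L H H γ₀ ∩ Function.support fun δ => classOrbitalIntegral m f δ).Finite) :
    stableOrbitalSum (cmConjRingHom L) H (fun c => classOrbitalIntegral m f (ConjClasses.map (UnitaryGroup.cmDatum L 3 H).toAdelic c)) γ₀ =
        (Fintype.card 𝓡 : ℂ)⁻¹ * (adelicStableOrbitalSum (MatchingAdeleG₂.classes L H H γ₀) m f +
          ∑ i, adelicKappaOrbitalSum (MatchingAdeleG₂.classes L H H γ₀) (W i) m f) ∧
      Fintype.card 𝓡 = Fintype.card I + 1 := by
  classical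
  -- the parametrisation of `𝓡 ∖ {1}` by `I`
  have he1 : ∀ i, ((e i : 𝓡)) ≠ 1 := fun i => (e i).2
  have heinj : Function.Injective fun i => ((e i : {χ : 𝓡 // χ ≠ 1}) : 𝓡) := fun i j h => e.injective (Subtype.ext h)
  have hsurj : ∀ κ : 𝓡, κ ≠ 1 → ∃ i, ((e i : {χ : 𝓡 // χ ≠ 1}) : 𝓡) = κ := fun κ hκ =>
    ⟨e.symm ⟨κ, hκ⟩, by rw [Equiv.apply_symm_apply]⟩
  -- one weight function on all of `𝓡`: `1` at `κ = 1`, `W i` at `κ = e i`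
  let w : 𝓡 → ConjClasses (UnitaryGroup.cmDatum L 3 H).Adelic → ℂ := fun κ δ => if h : κ = 1 then 1 else W (e.symm ⟨κ, h⟩) δ
  have hw : ∀ (κ : 𝓡) (q : MatchingAdeleG₂ L H H γ₀), w κ (ConjClasses.mk q.adele) = (κ : AddChar A ℂ) (obs q) := by
    intro κ q
    by_cases h : κ = 1
    · subst h
      simp only [w, dif_pos rfl, Subgroup.coe_one, AddChar.one_apply]
    · simp only [w, dif_neg h]
      rw [hW, Equiv.apply_symm_apply]
  have hwe : ∀ i, w ((e i : {χ : 𝓡 // χ ≠ 1}) : 𝓡) = W i := by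
    intro i
    funext δ
    simp only [w, dif_neg (e i).2]
    rw [Subtype.coe_eta, Equiv.symm_apply_apply]
  refine ⟨?_, card_subgroup_eq_card_add_one 𝓡 _ he1 heinj hsurj⟩
  have key := MatchingAdeleG₂.stableOrbitalSum_map_toAdelic_eq_inv_card_mul_stable_add_sum 𝓡 obs (fun i => ((e i : {χ : 𝓡 // χ ≠ 1}) : 𝓡)) he1 heinj hsurj
    hHasse hinj w hw m f hfin
  refine key.trans ?_
  congr 2
  exact Finset.sum_congr rfl fun i _ => by rw [hwe i]

/-- **Type (3)** (every matching adèle over `γ₀` rational — print: `𝓡(G_γ₀∕F)` trivial, `𝒪_st(γ₀)` not from `H`): the rational-class sum IS the adelic stable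
orbital integral, `Σ_{[γ] ⊂ 𝒪_st(γ₀)} Φ_m([toAdelic γ], f) = Φ^{st,𝐀}(γ₀, f)`. [cite: Rogawski1990, §5.4 p. 73] -/
theorem MatchingAdeleG₂.stableOrbitalSum_map_toAdelic_eq_adelicStableOrbitalSum_of_forall_isRationalOver
    (hall : ∀ p : MatchingAdeleG₂ L H H γ₀, ∃ γ, p.IsRationalOver γ)
    (hinj : Set.InjOn (ConjClasses.map (UnitaryGroup.cmDatum L 3 H).toAdelic) (conjClassesIn (cmConjRingHom L) H γ₀))
    (m : OrbitalMeasureFamily (UnitaryGroup.cmDatum L 3 H).Adelic) (f : (UnitaryGroup.cmDatum L 3 H).Adelic → ℂ) :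
    stableOrbitalSum (cmConjRingHom L) H (fun c => classOrbitalIntegral m f (ConjClasses.map (UnitaryGroup.cmDatum L 3 H).toAdelic c)) γ₀ =
      adelicStableOrbitalSum (MatchingAdeleG₂.classes L H H γ₀) m f :=
  stableOrbitalSum_comp_eq_adelicStableOrbitalSum_of_forall_mem_image (cmConjRingHom L) H γ₀ (MatchingAdeleG₂.classes L H H γ₀)
    (ConjClasses.map (UnitaryGroup.cmDatum L 3 H).toAdelic) m f hinj (fun c hc => MatchingAdeleG₂.map_toAdelic_mem_classes γ₀ hc)
    (fun δ hδ => by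
      obtain ⟨p, rfl⟩ := hδ
      exact p.exists_isRationalOver_iff_mk_mem_image.mp (hall p))

end Self

end Literature.NumberTheory.Rogawski1990
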